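import Summits.QuantumFields.YangMills.Theorems.UnitScaleTiltProp7HermiteSecondDiff
import Summits.QuantumFields.YangMills.Theorems.UnitScaleTiltProp7HermiteProfile
import HarnessLib

/-!
# Route `UnitScaleTilt`, crux K1 «MinimiserStabilityRegPr» (stmt-QuantumFields-19200), route-R E′ path (α′), row LEMMA-H-CURVED — FILE 2c(ii):
# THE FLAT C¹ HERMITE EXTENSION — second-difference rows of the Hermite fold and the LAPLACIAN ENERGY COUNT
# `(L^k)⁴·Σ_x (Δφ)(x)² ≤ 144d·(L^k)^d·Σ_c (f(c₊) − f(c₋))²` for an extension `φ` of `f` from the k-centres (`φ ∘ embIter k = f`); at `d = 3`: `ℓ·Σ|Δφ|² ≤ 432·Σ_c|δ_c f|²`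

Cell `ym3-torus`, D-0154 (3c) twin-width seat `ym-routeR-w1` (gen 5); row «routeR-w1 g5: LEMMA-H-CURVED» (namer ★ym-ust-19200-p1 g14, 2026-08-28 17:33Z; «F-H2 GO» 17:48Z).
THEOREMS ONLY (0 `def`, 0 `sorry`); `--supports stmt-QuantumFields-19200`, count-neutral.  YM₃ on T³ is a ladder rung (R3), not the Clay problem; nothing here claims a stub, the
crux, d = 4 or the mass gap.

WHY.  LEMMA-H-curved ⟸ biharmonic Dirichlet principle (✓ `Prop7CentreBiharmonicDirichlet`, F-H1) + ONE explicit extension of the centre data with Laplacian energy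
`O(ℓ⁻¹·Σ_c|δ_c f|²)` (d = 3).  THIS FILE completes the FLAT extension: `φ = H(f ∘ B^k(· − h𝟙))`, `H` the Hermite fold of ✓ `Prop7HermiteFold` with the C¹ profile of
✓ `Prop7HermiteProfile` (kept ABSTRACT as `p` with its displayed rows until the last theorem).  Per direction `μ`: pull `H_μ` out of the fold (`Φ = H_μF`, `F` the fold over
the other directions, constant along the `μ`-runs); the three values `H_μF(x ± e_μ), H_μF(x)` are blends of `F(x)` and `F(x ± ℓe_μ)` with the profile at offsets `r ± 1, r`
(§1: interior `Δ²_μ = (p(r+1) − 2p(r) + p(r−1))·(F(x) − F(x+ℓe_μ))`, knot `Δ²_μ = p(ℓ−1)·(F(x+ℓe_μ) − 2F(x) + F(x−ℓe_μ))`), so `|Δ²_μΦ(x)| ≤ (6∕ℓ²)(|F(x+ℓe_μ) − F(x)| + |F(x) − F(x−ℓe_μ)|)`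
(§2); the long differences of `F` are folds of the long difference `δ⁺g = g(· + ℓe_μ) − g` (translations in direction `μ` commute with the other factors), convexity gives
`(Δ²_μΦ)² ≤ (72∕ℓ⁴)·(H'((δ⁺g)²)(x) + H'((δ⁺g)²)(x − ℓe_μ))` and EXACT MASS PRESERVATION sums it to `(144∕ℓ⁴)·Σ_x (g(x+ℓe_μ) − g(x))² = 144·ℓ^(d−4)·Σ_y (f(y+e_μ) − f(y))²` (§3, the
fibre count of ✓ `Prop7TentInterpolation`).  Summing the directions with `(Σ_μ a_μ)² ≤ d·Σa_μ²` gives the Laplacian row and §4 instantiates the profile: ★★★ `exists_hermiteInterpolant`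
in the letters of the ENGINE's `hH` (`laplace 1`, `embIter k`).
WHAT THIS GIVES.  Together with F-H1 (flat reading) a constructive flat LEMMA H (`C_H = 432·(...)` vs the Fourier `3π⁴∕4` of ✓ `lemmaH_flat`) — not needed by the flat engine; its
PURPOSE is F-H3: the same weights, transported along `W`, give the curved extension (curvature enters only through the transports).
HONEST SCOPE.  Flat, real-valued, linear; the profile rows are ✓ `Prop7HermiteProfile`; nothing curved, nothing of Bałaban's beyond the cited letters.

References: T. Bałaban, CMP 95 (1984) 17–40 [Balaban1984PropagatorsI] ((1.18) p.20, (1.29)–(1.31) p.23); CMP 102 (1985) 277–309 [Balaban1985Variational] (Prop. 7 p.299).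
-/

set_option autoImplicit false

noncomputable section

open scoped BigOperators

namespace Summit.QuantumFields.YangMills.Theorems.Prop7HermiteInterpolation

open Literature.MathematicalPhysics.QuantumFieldTheory.Balaban1983to89
open Finset
open Summit.QuantumFields.YangMills.Theorems.Prop7TentInterpolation (sum_translate shift_eq_update update_update_add iterBlockOf_update_pow sum_comp_iterBlockOf)
open Summit.QuantumFields.YangMills.Theorems.Prop7HermiteOffsets (offset_lt offset_add_ell offset_shift offset_unshift corner_shift_of_lt corner_shift_of_eq
  corner_unshift_of_pos corner_unshift_of_zero corner_add_ell offset_update_ne)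
open Summit.QuantumFields.YangMills.Theorems.Prop7HermiteFold (update_comm_abs foldr_translate foldr_add foldr_sub foldr_smul foldr_eq_hermStep_erase foldr_abs_le foldr_sq_le
  foldr_mono runConst_foldr sum_foldr_eq foldr_embIter)
open B5Eq118OneStroke (iterBlockOf val_iterBlockOf)
open B15DeterminingSets (embIter)

variable {P : Params}

open Summit.QuantumFields.YangMills.Theorems.Prop7HermiteSecondDiff (sum_sq_secondDiff_foldr_le)

/-! ## §4 The block-constant input `g = f ∘ B^k(· − h𝟙)`, the Laplacian row, and the extension theorem -/

section Assembly

variable (ℓ : ℕ) (h : ZMod (P.sitesPerDir 0)) (p : ℕ → ℝ)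

/-- two fine sites with the same labels-div-`L^k` have the same `k`-block point. [cite: Balaban1984PropagatorsI, (1.6) p.18] -/
theorem iterBlockOf_eq_of_div_eq {k : ℕ} (hk : k ≤ P.m + P.K) (z z' : Site P 0) (hzz : ∀ κ : Fin P.d, (z κ).val / P.L ^ k = (z' κ).val / P.L ^ k) :
    iterBlockOf k z = iterBlockOf k z' := by
  funext κ
  apply ZMod.val_injective
  rw [val_iterBlockOf k hk, val_iterBlockOf k hk, hzz κ]

/-- **`g = f ∘ B^k(· − h𝟙)` IS CONSTANT ALONG EVERY RUN** (`ℓ = L^k`): moving `x` to its centre line does not change the `k`-block of `x − h𝟙`.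
[cite: Balaban1984PropagatorsI, (1.18) p.20] -/
theorem runConst_blockInput {k : ℕ} (hk : k ≤ P.m + P.K) (f : Site P k → ℝ) (ν : Fin P.d) (x : Site P 0) :
    (fun x : Site P 0 => f (iterBlockOf k (fun κ => x κ - h))) x
      = (fun x : Site P 0 => f (iterBlockOf k (fun κ => x κ - h))) (Function.update x ν (x ν - ((((x ν - h).val % P.L ^ k : ℕ)) : ZMod (P.sitesPerDir 0)))) := by
  simp only []
  congr 1
  refine iterBlockOf_eq_of_div_eq hk _ _ fun κ => ?_
  by_cases hκ : κ = ν
  · subst hκ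
    rw [Function.update_self]
    set a : ZMod (P.sitesPerDir 0) := x κ - h with ha
    set r : ℕ := a.val % P.L ^ k with hr
    have hrle : r ≤ a.val := Nat.mod_le _ _
    have e : x κ - (r : ZMod (P.sitesPerDir 0)) - h = (((a.val - r : ℕ)) : ZMod (P.sitesPerDir 0)) := by
      rw [Nat.cast_sub hrle, ZMod.natCast_zmod_val]; ring
    rw [e, ZMod.val_natCast, Nat.mod_eq_of_lt (lt_of_le_of_lt (Nat.sub_le _ _) (ZMod.val_lt a))]
    have hdm := Nat.mod_add_div a.val (P.L ^ k)
    rw [show a.val - r = P.L ^ k * (a.val / P.L ^ k) by omega, Nat.mul_div_cancel_left _ (pow_pos P.L_pos k)]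
  · rw [Function.update_of_ne hκ]

/-- the translate `x ↦ x − h𝟙` is a bijection of the finest torus: site sums are invariant. [folklore] -/
theorem sum_subConst (G : Site P 0 → ℝ) : ∑ x : Site P 0, G (fun κ => x κ - h) = ∑ x : Site P 0, G x :=
  Fintype.sum_equiv ⟨fun x => fun κ => x κ - h, fun x => fun κ => x κ + h, fun x => by funext κ; simp, fun x => by funext κ; simp⟩ _ _ (fun _ => rfl)

/-- **THE LONG DIFFERENCES OF `g` ARE COARSE DIFFERENCES OF `f`, EACH COUNTED `L^{kd}` TIMES**:
`Σ_x (g(x + L^k e_μ) − g(x))² = (L^d)^k·Σ_y (f(y + e_μ) − f(y))²`. [cite: Balaban1984PropagatorsI, (1.18) p.20] -/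
theorem sum_sq_longDiff_blockInput {k : ℕ} (hk : k ≤ P.m + P.K) (f : Site P k → ℝ) (μ : Fin P.d) :
    ∑ x : Site P 0, ((fun x : Site P 0 => f (iterBlockOf k (fun κ => x κ - h))) (Function.update x μ (x μ + ((P.L ^ k : ℕ) : ZMod (P.sitesPerDir 0))))
        - (fun x : Site P 0 => f (iterBlockOf k (fun κ => x κ - h))) x) ^ 2
      = (((P.L ^ P.d) ^ k : ℕ) : ℝ) * ∑ y : Site P k, (f (y.shift μ) - f y) ^ 2 := by
  have e : ∀ x : Site P 0, (fun κ => (Function.update x μ (x μ + ((P.L ^ k : ℕ) : ZMod (P.sitesPerDir 0)))) κ - h)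
      = Function.update (fun κ => x κ - h) μ ((fun κ => x κ - h) μ + (((P.L ^ k : ℕ) : ℕ) : ZMod (P.sitesPerDir 0))) := by
    intro x; funext κ
    by_cases hκ : κ = μ
    · subst hκ; simp only [Function.update_self]; push_cast; ring
    · simp only [Function.update_of_ne hκ]
  simp only [e]
  rw [sum_subConst h (fun z => (f (iterBlockOf k (Function.update z μ (z μ + (((P.L ^ k : ℕ) : ℕ) : ZMod (P.sitesPerDir 0))))) - f (iterBlockOf k z)) ^ 2),
    ← sum_comp_iterBlockOf hk (fun y => (f (y.shift μ) - f y) ^ 2)]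
  refine Finset.sum_congr rfl fun z _ => ?_
  rw [iterBlockOf_update_pow hk z μ]

/-- the positive Laplacian of `LatticeFieldCalculus` is minus the sum of the directional second differences; squared: `(Δφ)(x)² = (Σ_μ Δ²_μφ(x))²`.
[cite: Balaban1984PropagatorsI, (1.21) p.21] -/
theorem laplace_one_sq (φ : Site P 0 → ℝ) (x : Site P 0) :
    (LatticeFieldCalculus.laplace 1 φ x) ^ 2 = (∑ μ : Fin P.d, (φ (x.shift μ) - 2 * φ x + φ (x.unshift μ))) ^ 2 := by
  have e : LatticeFieldCalculus.laplace 1 φ x = -∑ μ : Fin P.d, (φ (x.shift μ) - 2 * φ x + φ (x.unshift μ)) := by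
    simp only [LatticeFieldCalculus.laplace, one_pow, one_smul, ← Finset.sum_neg_distrib]
    exact Finset.sum_congr rfl fun μ _ => by ring
  rw [e, neg_sq]

/-- Cauchy–Schwarz over the directions: `(Σ_μ a_μ)² ≤ d·Σ_μ a_μ²`. [folklore] -/
theorem sq_sum_le_card_mul (a : Fin P.d → ℝ) : (∑ μ : Fin P.d, a μ) ^ 2 ≤ (P.d : ℝ) * ∑ μ : Fin P.d, a μ ^ 2 := by
  have h1 := Finset.sum_mul_sq_le_sq_mul_sq (Finset.univ : Finset (Fin P.d)) (fun _ => (1 : ℝ)) a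
  simpa [one_pow, Finset.card_univ, Fintype.card_fin] using h1

/-- ★★ **THE LAPLACIAN ENERGY OF THE HERMITE EXTENSION** (profile abstract, `ℓ = L^k`): for every `f` on `T^{(k)}`,
`(L^k)⁴·Σ_x (Δ H(f∘B^k(·−h𝟙)))(x)² ≤ 144·d·(L^d)^k·Σ_c (f(c₊) − f(c₋))²`. [cite: Balaban1984PropagatorsI, (1.18) p.20, (1.29)-(1.31) p.23] -/
theorem sum_sq_laplace_foldr_le {k : ℕ} (hk : k ≤ P.m + P.K) (hp0 : p 0 = 1) (hpℓ : p (P.L ^ k) = 0)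
    (hp01 : ∀ r : ℕ, r < P.L ^ k → 0 ≤ p r ∧ p r ≤ 1)
    (hpD : ∀ r : ℕ, 1 ≤ r → r + 1 ≤ P.L ^ k → |p (r + 1) - 2 * p r + p (r - 1)| ≤ 6 / ((P.L ^ k : ℕ) : ℝ) ^ 2)
    (hpc : p 1 + p (P.L ^ k - 1) = 1) (hpk : p (P.L ^ k - 1) ≤ 3 / ((P.L ^ k : ℕ) : ℝ) ^ 2) (f : Site P k → ℝ) :
    (((P.L ^ k : ℕ) : ℝ)) ^ 4 * ∑ x : Site P 0, (LatticeFieldCalculus.laplace 1 (List.foldr (fun (μ : Fin P.d) (w : Site P 0 → ℝ) (x : Site P 0) => p ((x μ - h).val % P.L ^ k) * w (Function.update x μ (x μ - ((((x μ - h).val % P.L ^ k : ℕ)) : ZMod (P.sitesPerDir 0)))) + (1 - p ((x μ - h).val % P.L ^ k)) * w (Function.update x μ (x μ - ((((x μ - h).val % P.L ^ k : ℕ)) : ZMod (P.sitesPerDir 0)) + ((P.L ^ k : ℕ) : ZMod (P.sitesPerDir 0))))) (fun x : Site P 0 => f (iterBlockOf k (fun ν => x ν - h))) (List.finRange P.d))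 x) ^ 2
      ≤ 144 * (P.d : ℝ) * (((P.L ^ P.d) ^ k : ℕ) : ℝ) * ∑ c : PBond P k, (f c.tgt - f c.src) ^ 2 := by
  have hℓ : 0 < P.L ^ k := pow_pos P.L_pos k
  have hℓr : (0 : ℝ) < ((P.L ^ k : ℕ) : ℝ) := by exact_mod_cast hℓ
  have hℓN : P.L ^ k ∣ P.sitesPerDir 0 := ⟨P.sitesPerDir k, by
    unfold Params.sitesPerDir; rw [Nat.sub_zero, mul_left_comm, ← pow_add, Nat.add_sub_cancel' hk]⟩
  have hg : ∀ ν : Fin P.d, ∀ x : Site P 0, (fun x : Site P 0 => f (iterBlockOf k (fun ν => x ν - h))) x = (fun x : Site P 0 => f (iterBlockOf k (fun ν => x ν - h))) (Function.update x ν (x ν - ((((x ν - h).val % P.L ^ k : ℕ)) : ZMod (P.sitesPerDir 0)))) :=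
    fun ν x => runConst_blockInput h hk f ν x
  -- per direction
  have hdir : ∀ μ : Fin P.d, ∑ x : Site P 0, ((List.foldr (fun (μ : Fin P.d) (w : Site P 0 → ℝ) (x : Site P 0) => p ((x μ - h).val % P.L ^ k) * w (Function.update x μ (x μ - ((((x μ - h).val % P.L ^ k : ℕ)) : ZMod (P.sitesPerDir 0)))) + (1 - p ((x μ - h).val % P.L ^ k)) * w (Function.update x μ (x μ - ((((x μ - h).val % P.L ^ k : ℕ)) : ZMod (P.sitesPerDir 0)) + ((P.L ^ k : ℕ) : ZMod (P.sitesPerDir 0))))) (fun x : Site P 0 => f (iterBlockOf k (fun ν => x ν - h))) (List.finRange P.d)) (x.shift μ) - 2 * (List.foldr (fun (μ : Fin P.d) (w : Site P 0 → ℝ) (x : Site P 0) => p ((x μ - h).val % P.L ^ k) * w (Function.update x μ (x μ - ((((x μ - h).val % P.L ^ k : ℕ)) : ZMod (P.sitesPerDir 0)))) + (1 - p ((x μ - h).val % P.L ^ k)) * w (Function.update x μ (x μ - ((((x μ - h).val % P.L ^ k : ℕ)) : ZMod (P.sitesPerDir 0)) + ((P.L ^ k : ℕ) : ZMod (P.sitesPerDir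 0))))) (fun x : Site P 0 => f (iterBlockOf k (fun ν => x ν - h))) (List.finRange P.d)) x
      + (List.foldr (fun (μ : Fin P.d) (w : Site P 0 → ℝ) (x : Site P 0) => p ((x μ - h).val % P.L ^ k) * w (Function.update x μ (x μ - ((((x μ - h).val % P.L ^ k : ℕ)) : ZMod (P.sitesPerDir 0)))) + (1 - p ((x μ - h).val % P.L ^ k)) * w (Function.update x μ (x μ - ((((x μ - h).val % P.L ^ k : ℕ)) : ZMod (P.sitesPerDir 0)) + ((P.L ^ k : ℕ) : ZMod (P.sitesPerDir 0))))) (fun x : Site P 0 => f (iterBlockOf k (fun ν => x ν - h))) (List.finRange P.d)) (x.unshift μ)) ^ 2 ≤ 144 / ((P.L ^ k : ℕ) : ℝ) ^ 4 * ((((P.L ^ P.d) ^ k : ℕ) : ℝ) * ∑ y : Site P k, (f (y.shift μ) - f y) ^ 2) := by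
    intro μ
    rw [← sum_sq_longDiff_blockInput h hk f μ]
    exact sum_sq_secondDiff_foldr_le (P.L ^ k) h p hℓN hℓ hp0 hpℓ hp01 hpD hpc hpk (fun x : Site P 0 => f (iterBlockOf k (fun ν => x ν - h))) hg μ
  -- assemble
  calc (((P.L ^ k : ℕ) : ℝ)) ^ 4 * ∑ x : Site P 0, (LatticeFieldCalculus.laplace 1 (List.foldr (fun (μ : Fin P.d) (w : Site P 0 → ℝ) (x : Site P 0) => p ((x μ - h).val % P.L ^ k) * w (Function.update x μ (x μ - ((((x μ - h).val % P.L ^ k : ℕ)) : ZMod (P.sitesPerDir 0)))) + (1 - p ((x μ - h).val % P.L ^ k)) * w (Function.update x μ (x μ - ((((x μ - h).val % P.L ^ k : ℕ)) : ZMod (P.sitesPerDir 0)) + ((P.L ^ k : ℕ) : ZMod (P.sitesPerDir 0))))) (fun x : Site P 0 => f (iterBlockOf k (fun ν => x ν - h))) (List.finRange P.d)) x) ^ 2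
      ≤ (((P.L ^ k : ℕ) : ℝ)) ^ 4 * ∑ x : Site P 0, ((P.d : ℝ) * ∑ μ : Fin P.d, ((List.foldr (fun (μ : Fin P.d) (w : Site P 0 → ℝ) (x : Site P 0) => p ((x μ - h).val % P.L ^ k) * w (Function.update x μ (x μ - ((((x μ - h).val % P.L ^ k : ℕ)) : ZMod (P.sitesPerDir 0)))) + (1 - p ((x μ - h).val % P.L ^ k)) * w (Function.update x μ (x μ - ((((x μ - h).val % P.L ^ k : ℕ)) : ZMod (P.sitesPerDir 0)) + ((P.L ^ k : ℕ) : ZMod (P.sitesPerDir 0))))) (fun x : Site P 0 => f (iterBlockOf k (fun ν => x ν - h))) (List.finRange P.d)) (x.shift μ) - 2 * (List.foldr (fun (μ : Fin P.d) (w : Site P 0 → ℝ) (x : Site P 0) => p ((x μ - h).val % P.L ^ k) * w (Function.update x μ (x μ - ((((x μ - h).val % P.L ^ k : ℕ)) : ZMod (P.sitesPerDir 0)))) + (1 - p ((x μ - h).val % P.L ^ k)) * w (Function.update x μ (x μ - ((((x μ - h).val % P.L ^ k : ℕ)) : ZMod (P.sitesPerDir 0)) + ((P.L ^ k : ℕ)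 : ZMod (P.sitesPerDir 0))))) (fun x : Site P 0 => f (iterBlockOf k (fun ν => x ν - h))) (List.finRange P.d)) x
          + (List.foldr (fun (μ : Fin P.d) (w : Site P 0 → ℝ) (x : Site P 0) => p ((x μ - h).val % P.L ^ k) * w (Function.update x μ (x μ - ((((x μ - h).val % P.L ^ k : ℕ)) : ZMod (P.sitesPerDir 0)))) + (1 - p ((x μ - h).val % P.L ^ k)) * w (Function.update x μ (x μ - ((((x μ - h).val % P.L ^ k : ℕ)) : ZMod (P.sitesPerDir 0)) + ((P.L ^ k : ℕ) : ZMod (P.sitesPerDir 0))))) (fun x : Site P 0 => f (iterBlockOf k (fun ν => x ν - h))) (List.finRange P.d)) (x.unshift μ)) ^ 2) := by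
        refine mul_le_mul_of_nonneg_left (Finset.sum_le_sum fun x _ => ?_) (by positivity)
        rw [laplace_one_sq]
        exact sq_sum_le_card_mul _
    _ = (((P.L ^ k : ℕ) : ℝ)) ^ 4 * ((P.d : ℝ) * ∑ μ : Fin P.d, ∑ x : Site P 0, ((List.foldr (fun (μ : Fin P.d) (w : Site P 0 → ℝ) (x : Site P 0) => p ((x μ - h).val % P.L ^ k) * w (Function.update x μ (x μ - ((((x μ - h).val % P.L ^ k : ℕ)) : ZMod (P.sitesPerDir 0)))) + (1 - p ((x μ - h).val % P.L ^ k)) * w (Function.update x μ (x μ - ((((x μ - h).val % P.L ^ k : ℕ)) : ZMod (P.sitesPerDir 0)) + ((P.L ^ k : ℕ) : ZMod (P.sitesPerDir 0))))) (fun x : Site P 0 => f (iterBlockOf k (fun ν => x ν - h))) (List.finRange P.d)) (x.shift μ) - 2 * (List.foldr (fun (μ : Fin P.d) (w : Site P 0 → ℝ) (x : Site P 0) => p ((x μ - h).val % P.L ^ k) * w (Function.update x μ (x μ - ((((x μ - h).val % P.L ^ k : ℕ)) : ZMod (P.sitesPerDir 0)))) + (1 - p ((x μ - h).val % P.L ^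 k)) * w (Function.update x μ (x μ - ((((x μ - h).val % P.L ^ k : ℕ)) : ZMod (P.sitesPerDir 0)) + ((P.L ^ k : ℕ) : ZMod (P.sitesPerDir 0))))) (fun x : Site P 0 => f (iterBlockOf k (fun ν => x ν - h))) (List.finRange P.d)) x
          + (List.foldr (fun (μ : Fin P.d) (w : Site P 0 → ℝ) (x : Site P 0) => p ((x μ - h).val % P.L ^ k) * w (Function.update x μ (x μ - ((((x μ - h).val % P.L ^ k : ℕ)) : ZMod (P.sitesPerDir 0)))) + (1 - p ((x μ - h).val % P.L ^ k)) * w (Function.update x μ (x μ - ((((x μ - h).val % P.L ^ k : ℕ)) : ZMod (P.sitesPerDir 0)) + ((P.L ^ k : ℕ) : ZMod (P.sitesPerDir 0))))) (fun x : Site P 0 => f (iterBlockOf k (fun ν => x ν - h))) (List.finRange P.d)) (x.unshift μ)) ^ 2) := by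
        rw [← Finset.mul_sum, Finset.sum_comm]
    _ ≤ (((P.L ^ k : ℕ) : ℝ)) ^ 4 * ((P.d : ℝ) * ∑ μ : Fin P.d, (144 / ((P.L ^ k : ℕ) : ℝ) ^ 4 * ((((P.L ^ P.d) ^ k : ℕ) : ℝ) * ∑ y : Site P k, (f (y.shift μ) - f y) ^ 2))) := by
        gcongr with μ _
        exact hdir μ
    _ = 144 * (P.d : ℝ) * (((P.L ^ P.d) ^ k : ℕ) : ℝ) * ∑ y : Site P k, ∑ μ : Fin P.d, (f (y.shift μ) - f y) ^ 2 := by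
        rw [← Finset.mul_sum, ← Finset.mul_sum, Finset.sum_comm]
        field_simp
    _ = 144 * (P.d : ℝ) * (((P.L ^ P.d) ^ k : ℕ) : ℝ) * ∑ c : PBond P k, (f c.tgt - f c.src) ^ 2 := by
        rw [B10StarCount.sum_pbond]; rfl

open Summit.QuantumFields.YangMills.Theorems.Prop7HermiteProfile (hermite_zero hermite_self hermite_add_hermite_sub hermite_nonneg hermite_le_one hermite_pred
  hermite_pred_le abs_hermite_secondDiff_le)

/-- ★★★ **THE FLAT C¹ HERMITE EXTENSION** (LEMMA-H-curved, F-H2c): every `f` on the `k`-th lattice has an extension `φ` to the finest torus — `φ(embIter k y) = f(y)` at the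
centres — with `(L^k)⁴·Σ_x (Δφ)(x)² ≤ 144·d·(L^d)^k·Σ_c (f(c₊) − f(c₋))²` (`Δ = laplace 1`); at `d = 3` this is `L^k·Σ_x(Δφ)² ≤ 432·Σ_c(δ_c f)²`, LEMMA H's right side.
`φ` = the Hermite fold with profile `(1 − r∕ℓ)²(1 + 2r∕ℓ)`, `ℓ = L^k`, offset `h = (ℓ−1)∕2`, of `f ∘ B^k(· − h𝟙)`. [cite: Balaban1984PropagatorsI, (1.18) p.20, (1.29)-(1.31) p.23; Balaban1985Variational, Prop. 7 p.299] -/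
theorem exists_hermiteInterpolant (k : ℕ) (hk : k ≤ P.m + P.K) (f : Site P k → ℝ) :
    ∃ φ : Site P 0 → ℝ, (∀ y : Site P k, φ (embIter k y) = f y) ∧
      ((P.L : ℝ) ^ k) ^ 4 * ∑ x : Site P 0, (LatticeFieldCalculus.laplace 1 φ x) ^ 2
        ≤ 144 * (P.d : ℝ) * ((P.L : ℝ) ^ P.d) ^ k * ∑ c : PBond P k, (f c.tgt - f c.src) ^ 2 := by
  have hℓ : 0 < P.L ^ k := pow_pos P.L_pos k
  have hℓ1 : 1 ≤ P.L ^ k := hℓ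
  have hℓr : (0 : ℝ) < ((P.L ^ k : ℕ) : ℝ) := by exact_mod_cast hℓ
  have hℓr1 : (1 : ℝ) ≤ ((P.L ^ k : ℕ) : ℝ) := by exact_mod_cast hℓ1
  have hℓne : ((P.L ^ k : ℕ) : ℝ) ≠ 0 := hℓr.ne'
  refine ⟨(List.foldr (fun (μ : Fin P.d) (w : Site P 0 → ℝ) (x : Site P 0) => (fun r : ℕ => (1 - (r : ℝ) / ((P.L ^ k : ℕ) : ℝ)) ^ 2 * (1 + 2 * (r : ℝ) / ((P.L ^ k : ℕ) : ℝ))) ((x μ - ((((P.L ^ k - 1) / 2 : ℕ)) : ZMod (P.sitesPerDir 0))).val % P.L ^ k) * w (Function.update x μ (x μ - ((((x μ - ((((P.L ^ k - 1) / 2 : ℕ)) : ZMod (P.sitesPerDir 0))).val % P.L ^ k : ℕ)) : ZMod (P.sitesPerDir 0)))) + (1 - (fun r : ℕ => (1 - (r : ℝ) / ((P.L ^ k : ℕ) : ℝ)) ^ 2 * (1 + 2 * (r : ℝ) / ((P.L ^ k : ℕ) : ℝ))) ((x μ - ((((P.L ^ k - 1) / 2 : ℕ)) : ZMod (P.sitesPerDir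 0))).val % P.L ^ k)) * w (Function.update x μ (x μ - ((((x μ - ((((P.L ^ k - 1) / 2 : ℕ)) : ZMod (P.sitesPerDir 0))).val % P.L ^ k : ℕ)) : ZMod (P.sitesPerDir 0)) + ((P.L ^ k : ℕ) : ZMod (P.sitesPerDir 0))))) (fun x : Site P 0 => f (iterBlockOf k (fun ν => x ν - ((((P.L ^ k - 1) / 2 : ℕ)) : ZMod (P.sitesPerDir 0))))) (List.finRange P.d)), fun y => foldr_embIter hk (fun r : ℕ => (1 - (r : ℝ) / ((P.L ^ k : ℕ) : ℝ)) ^ 2 * (1 + 2 * (r : ℝ) / ((P.L ^ k : ℕ) : ℝ))) (by simp) f y, ?_⟩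
  have hmain := sum_sq_laplace_foldr_le ((((P.L ^ k - 1) / 2 : ℕ)) : ZMod (P.sitesPerDir 0)) (fun r : ℕ => (1 - (r : ℝ) / ((P.L ^ k : ℕ) : ℝ)) ^ 2 * (1 + 2 * (r : ℝ) / ((P.L ^ k : ℕ) : ℝ))) hk (by simp) ?_ ?_ ?_ ?_ ?_ f
  · have e1 : ((P.L : ℝ) ^ k) ^ 4 = (((P.L ^ k : ℕ) : ℝ)) ^ 4 := by push_cast; ring
    have e2 : ((P.L : ℝ) ^ P.d) ^ k = (((P.L ^ P.d) ^ k : ℕ) : ℝ) := by push_cast; ring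
    rw [e1, e2]
    exact hmain
  · -- `p(ℓ) = 0`
    exact hermite_self hℓne
  · -- values in `[0,1]`
    intro r hr
    have hr' : (r : ℝ) ≤ ((P.L ^ k : ℕ) : ℝ) := by exact_mod_cast hr.le
    exact ⟨hermite_nonneg hℓr (Nat.cast_nonneg r), hermite_le_one hℓr hr'⟩
  · -- second differences
    intro r hr1 hr2
    have h0 : (0 : ℝ) ≤ (r : ℝ) := Nat.cast_nonneg r
    have h1 : (r : ℝ) ≤ ((P.L ^ k : ℕ) : ℝ) := by exact_mod_cast (by omega : r ≤ P.L ^ k)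
    have e := abs_hermite_secondDiff_le hℓr h0 h1
    rw [Nat.cast_sub hr1, Nat.cast_add, Nat.cast_one]
    exact e
  · -- complement at the knot
    rw [Nat.cast_sub hℓ1, Nat.cast_one]
    exact hermite_add_hermite_sub hℓne 1
  · -- knot value
    rw [Nat.cast_sub hℓ1, Nat.cast_one, hermite_pred hℓne]
    exact hermite_pred_le hℓr1

/-- ★★★ the `d = 3` reading in the ENGINE's `hH` currency: `L^k·Σ_x (Δφ)(x)² ≤ 432·Σ_c (f(c₊) − f(c₋))²` for an extension `φ` of `f` from the k-centres.
[cite: Balaban1984PropagatorsI, (1.29)-(1.31) p.23; Balaban1985Variational, Prop. 7 p.299] -/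
theorem exists_hermiteInterpolant_d3 (hd : P.d = 3) (k : ℕ) (hk : k ≤ P.m + P.K) (f : Site P k → ℝ) :
    ∃ φ : Site P 0 → ℝ, (∀ y : Site P k, φ (embIter k y) = f y) ∧
      (P.L : ℝ) ^ k * ∑ x : Site P 0, (LatticeFieldCalculus.laplace 1 φ x) ^ 2 ≤ 432 * ∑ c : PBond P k, (f c.tgt - f c.src) ^ 2 := by
  obtain ⟨φ, hφ, hE⟩ := exists_hermiteInterpolant k hk f
  refine ⟨φ, hφ, ?_⟩
  rw [hd] at hE
  have hL : (0 : ℝ) < (P.L : ℝ) ^ k := by have := P.L_pos; positivity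
  have hS : 0 ≤ ∑ x : Site P 0, (LatticeFieldCalculus.laplace 1 φ x) ^ 2 := Finset.sum_nonneg fun _ _ => sq_nonneg _
  have e : ((P.L : ℝ) ^ 3) ^ k = ((P.L : ℝ) ^ k) ^ 3 := by ring
  rw [e] at hE
  push_cast at hE
  have key : ((P.L : ℝ) ^ k) ^ 3 * ((P.L : ℝ) ^ k * ∑ x : Site P 0, (LatticeFieldCalculus.laplace 1 φ x) ^ 2)
      ≤ ((P.L : ℝ) ^ k) ^ 3 * (432 * ∑ c : PBond P k, (f c.tgt - f c.src) ^ 2) := by nlinarith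
  exact le_of_mul_le_mul_left key (by positivity)

end Assembly

end Summit.QuantumFields.YangMills.Theorems.Prop7HermiteInterpolation

end
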